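import Summits.HubbardSuperconductivity.HubbardSuperconductivity.Theses.AposterioriCapRg
import Summits.HubbardSuperconductivity.HubbardSuperconductivity.Theorems.AposterioriCapRgCapRgSymmetricCertificatePinnedStubCooperC4v
import Summits.HubbardSuperconductivity.HubbardSuperconductivity.Theorems.AposterioriCapRgCapRgSymmetricCertificatePinnedStubDominanceOfMargins
import Summits.HubbardSuperconductivity.HubbardSuperconductivity.Theorems.AposterioriCapRgCapRgSymmetricCertificatePinnedStubShellGeometryStable
import Summits.HubbardSuperconductivity.HubbardSuperconductivity.Theorems.AposterioriCapRgCapRgSymmetricCertificatePinnedStubDensityOfBracket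
import Summits.HubbardSuperconductivity.HubbardSuperconductivity.Theorems.AposterioriCapRgCapRgSymmetricCertificatePinnedStubCertificateOfPerAccuracy

/-!
# Line `strict-continuum-certificate-transfer` for crux `CapRgSymmetricCertificatePinned`
# (item stmt-HubbardSuperconductivity-14045, route AposterioriCapRg) — the lead's skeleton, v4

Leads: prover-line-stmt-HubbardSuperconductivity-14045-0 (v1–v3), prover-line-stmt-HubbardSuperconductivity-14045-c1-0 (v4).
History: v1 (4 stubs rebuilt from the planner's registered signatures 700e110a) → three glue stubs LANDED (`stub_cooperC4v`
p89297, `stub_dominanceOfMargins` p85399, `stub_shellGeometryStable` p91237; imported above) → v3: the hardest stub reshaped to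
the per-accuracy form C⁺′ (`stub_perAccuracyCertificate`, frame and scale chosen AFTER the mismatch tolerance; C⁺ ⇒ C⁺′ proved
in v3, tree history 8:38Z) → v4 (this file): C⁺′ SPLIT along its two unrelated obligations.

Composition idea (card `Ideas/strict-continuum-certificate-transfer.md`): prove the crux from a certificate stated through
LIMITS of the tree's finite-`(L, β, M)` functionals (eventually along `M → ∞`, then `β → ∞`, then `L → ∞`) with STRICT
margins and with clause (ii′) `CooperDominance` replaced by OPEN spectral conditions (strict `B₁g` isotypic gap (G) and the
half-bottom bound on the second Rayleigh level (H4)); the crux's `∀ Θ = (c₀, w)` and its `∀ L ∃ β₀ ∀ β ∃ M₀ ∀ M` block are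
bookkeeping (`exists_window_of_mem_Ioo`, `block_of_eventually`), and (ii′) follows from (G)+(H4) by the landed
`stub_dominanceOfMargins` + `stub_cooperC4v` (`certificate_of_perAccuracy`, v3's composition factored out).

RESHAPE v3 → v4 (why).  C⁺′ bundled (a) the per-accuracy symmetric-regime certificate of the countertermed Grassmann action
(the ENGINE) with (b) the DENSITY conjunct `n_{L+1}(U, μ) → 1 − δ` of the operator model — a thermodynamic limit that no
symmetric-regime technique touches.  (b) is now DISCHARGED INSIDE THE SKELETON from tree theorems: the grand-canonical
ground-state energy density of the 2D Hubbard torus has a thermodynamic limit `g_U(μ)` for EVERY `U, μ` (Theorems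
`stub_torusGcEnergyDensityLimit` / `ptbm_gcLimit_exists`, routes WeakCouplingBCS / ThermalWedge), `g_U` is antitone
(`CwDensity.antitone_of_tendsto`, Theorems of route ChiralWindow); an antitone real function is differentiable
Lebesgue-a.e. (Mathlib `Monotone.ae_differentiableAt`), hence at SOME point of every open interval
(`CwDensity.exists_differentiableAt`, ibid.; Literature home proposed as p96990 `HubbardGrandCanonicalDensityBracket.lean`);
at such a point `μ*` Griffiths' lemma (`tendsto_gcDensity_of_hasDerivAt`,
`HubbardGrandCanonicalDensity.lean`) gives `n_{L+1}(U, μ*) → −g_U′(μ*)`, and the finite-volume monotonicity of the density in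
`μ` (`gcNumber_torus_mono`) transports two ONE-SIDED bounds at the ends of the interval, needed only FREQUENTLY in `L`, to the
limit (`densityClause_of_bracket`, proved below).  Hence the engine stub `stub_certificateOnInterval` carries NO density
limit, NO `δ` and NO differentiability: a coupling `U ∈ [2,3]`, an open window `(μ₁, μ₂)` of chemical potentials with
`13/20 ≤ n_{L+1}(U, μ₁)` and `n_{L+1}(U, μ₂) ≤ 4/5` frequently in `L`, and C⁺′'s per-accuracy block VERBATIM at every
`μ ∈ (μ₁, μ₂)`; the composition produces `δ := 1 − lim_L n_{L+1}(U, μ*) ∈ [1/5, 7/20]`.  (v3's C⁺′ at ONE `μ` does not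
imply v4's interval form and conversely; v4 is the cut along which the tree already proves the operator-side half.)

`CapRgSymmetricCertificatePinned_of` concludes the crux BY NAME; `sorry` occurs only in the ENGINE stub
`stub_certificateOnInterval`.  The two glue stubs of v4.2 (registered 630a5cd5) are LANDED and imported above:
`stub_densityOfBracket` (p97590, `Theorems/AposterioriCapRgCapRgSymmetricCertificatePinnedStubDensityOfBracket.lean`) and
`stub_certificateOfPerAccuracy` (p98129, `…StubCertificateOfPerAccuracy.lean`); Literature by-product p96990
`HubbardGrandCanonicalDensityBracket.lean` (general-`t` bracket lemma).  (v4.0, registered 775a117c, carried the operator-side facts as stubs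
`stub_gcLimit_antitone`, `stub_exists_differentiableAt_of_antitone`; both turned out to be tree theorems —
`stub_torusGcEnergyDensityLimit`, `CwDensity.antitone_of_tendsto`, `CwDensity.exists_differentiableAt` — so modulo landed
glue the crux IS its engine stub, kernel-checked.)
-/

noncomputable section

namespace Summit.HubbardSuperconductivity.CapRgSymmetricCertificatePinned.StrictContinuum

open Filter Topology
open Literature.MathematicalPhysics.QuantumLattice Literature.Probability.LatticeModels Matrix
open scoped BigOperators

/-! ## The registered stub (the only `sorry`: the engine) -/

/-- **Stub `stub_certificateOnInterval`** (HARDEST; the crux's engine content, density-free): at some coupling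
`U ∈ [2, 3]` there is an open window `(μ₁, μ₂)` of chemical potentials such that
(D₁) frequently in `L`, the grand-canonical tracial ground-state density of `hubbardTorusWith 2 (L+1) 1 U μ₁` is `≥ 13/20`;
(D₂) frequently in `L`, that of `hubbardTorusWith 2 (L+1) 1 U μ₂` is `≤ 4/5`;
(C) at EVERY `μ ∈ (μ₁, μ₂)`, FOR EVERY mismatch tolerance `c > 0` there are an admissible frame `K` and an admissible scale
`Λ` with the pinned shell geometry such that, eventually along `M → ∞`, then `β → ∞`, then `L → ∞` (torus side `L + 1`,
`2(M + 1)` Matsubara frequencies): the Fermi-curve mismatch is `< c + ½|e_K|` on the shell, the `d`-wave pairing strength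
converges to an interior window value `lam ∈ (1/8, 1/5)`, and the remaining clauses hold STRICTLY — normaliser `≠ 0`, field
strengths in `(ζ, 1/ζ)`, `‖𝒱₄‖_∞ < E₁`, truncated remainder `< E₃`, Stoner products `< 1 − σ`, strict `B₁g` isotypic gap
(G) and half-bottom second level (H4) of the Cooper matrix (v3's per-accuracy block C⁺′, verbatim, at this `μ`). -/
theorem stub_certificateOnInterval :
    ∃ U ∈ Set.Icc (2:ℝ) 3, ∃ μ₁ μ₂ : ℝ, μ₁ < μ₂ ∧
      (∃ᶠ L : ℕ in atTop, (13 / 20 : ℝ) ≤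
        ((hubbardTorusWith 2 (L + 1) 1 U μ₁).groundStateFunctional totalNumber).re / ((L + 1 : ℕ) : ℝ) ^ 2) ∧
      (∃ᶠ L : ℕ in atTop,
        ((hubbardTorusWith 2 (L + 1) 1 U μ₂).groundStateFunctional totalNumber).re / ((L + 1 : ℕ) : ℝ) ^ 2 ≤ 4 / 5) ∧
      ∀ μ ∈ Set.Ioo μ₁ μ₂,
      ∀ c : ℝ, 0 < c → ∃ (K : TrigPolyC4v) (Λ : ℝ),
        capRgCornerDataT.AdmitsFrameNorm (K.coeffNorm capRgCornerDataT.frameDecay) ∧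
        capRgCornerDataT.AdmitsScale Λ ∧
        ShellGeometry (renormalisedBandC μ K) Λ capRgCornerDataT.velLower capRgCornerDataT.velUpper
          capRgCornerDataT.curvLower capRgCornerDataT.curvUpper capRgCornerDataT.vanHoveDist ∧
        (∀ᶠ L : ℕ in atTop, ∀ᶠ β : ℝ in atTop, ∀ᶠ M : ℕ in atTop,
          ∀ k ∈ momentumShell (L + 1) (nambuXiCT (L + 1) μ K) Λ, ∀ σ : Fin 2,
            |(selfEnergy (L + 1) (M + 1) β (hubbardEffectiveActionCT (L + 1) (M + 1) β U μ 0 K Λ)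
                (omega0 (M + 1), k) σ).re| <
              c + capRgCornerDataT.slopeAllowance * |nambuXiCT (L + 1) μ K k|) ∧
        (∃ lam : ℝ, ((symmetricWindowLower : ℝ) < lam ∧ lam < symmetricWindowUpper) ∧
          ∀ η : ℝ, 0 < η → ∀ᶠ L : ℕ in atTop, ∀ᶠ β : ℝ in atTop, ∀ᶠ M : ℕ in atTop,
            |pairingStrength (L + 1) (M + 1) β (nambuXiCT (L + 1) μ K) Λ
                (hubbardEffectiveActionCT (L + 1) (M + 1) β U μ 0 K Λ) - lam| < η) ∧
        (∀ᶠ L : ℕ in atTop, ∀ᶠ β : ℝ in atTop, ∀ᶠ M : ℕ in atTop,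
          hubbardEffPartitionFnCT (L + 1) (M + 1) β U μ 0 K Λ ≠ 0 ∧
          (∀ k ∈ momentumShell (L + 1) (nambuXiCT (L + 1) μ K) Λ, ∀ σ : Fin 2,
            (capRgCornerDataT.fieldFloor : ℝ) <
                fieldStrengthSpin (L + 1) (M + 1) β (hubbardEffectiveActionCT (L + 1) (M + 1) β U μ 0 K Λ) k σ ∧
              fieldStrengthSpin (L + 1) (M + 1) β (hubbardEffectiveActionCT (L + 1) (M + 1) β U μ 0 K Λ) k σ <
                1 / capRgCornerDataT.fieldFloor) ∧
          vertexSupNorm (L + 1) (M + 1) β (hubbardEffectiveActionCT (L + 1) (M + 1) β U μ 0 K Λ) 4 <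
            capRgCornerDataT.quarticBound ∧
          remainderWeightNormUpTo (L + 1) (M + 1) capRgCornerDataT.remainderDegree β
              ((capRgCornerDataT.fieldRadius : ℝ) ^ 2 * Λ)
              (hubbardEffectiveActionCT (L + 1) (M + 1) β U μ 0 K Λ) < capRgCornerDataT.remainderBound ∧
          (∀ q : TorusSite 2 (L + 1),
            stonerCharge (L + 1) (M + 1) β (nambuXiCT (L + 1) μ K) Λ
                (hubbardEffectiveActionCT (L + 1) (M + 1) β U μ 0 K Λ) q < 1 - capRgCornerDataT.stonerMargin ∧
              stonerSpin (L + 1) (M + 1) β (nambuXiCT (L + 1) μ K) Λ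
                (hubbardEffectiveActionCT (L + 1) (M + 1) β U μ 0 K Λ) q < 1 - capRgCornerDataT.stonerMargin) ∧
          (⨅ f : {f : TorusSite 2 (L + 1) → ℂ // star f ⬝ᵥ f = 1 ∧ IsB1g f},
              reRayleigh (cooperMatrix (L + 1) (M + 1) β (nambuXiCT (L + 1) μ K) Λ
                (hubbardEffectiveActionCT (L + 1) (M + 1) β U μ 0 K Λ)) f.1) <
            ⨅ g : {g : TorusSite 2 (L + 1) → ℂ // star g ⬝ᵥ g = 1 ∧
                ∀ f : TorusSite 2 (L + 1) → ℂ, IsB1g f → star f ⬝ᵥ g = 0},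
              reRayleigh (cooperMatrix (L + 1) (M + 1) β (nambuXiCT (L + 1) μ K) Λ
                (hubbardEffectiveActionCT (L + 1) (M + 1) β U μ 0 K Λ)) g.1 ∧
          -(-cooperMatrix (L + 1) (M + 1) β (nambuXiCT (L + 1) μ K) Λ
                (hubbardEffectiveActionCT (L + 1) (M + 1) β U μ 0 K Λ)).supRayleigh / 2 ≤
            ⨆ f : {f : TorusSite 2 (L + 1) → ℂ // star f ⬝ᵥ f = 1},
              ⨅ g : {g : TorusSite 2 (L + 1) → ℂ // star g ⬝ᵥ g = 1 ∧ star f.1 ⬝ᵥ g = 0},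
                reRayleigh (cooperMatrix (L + 1) (M + 1) β (nambuXiCT (L + 1) μ K) Λ
                  (hubbardEffectiveActionCT (L + 1) (M + 1) β U μ 0 K Λ)) g.1) := by
  sorry

/-! ## The composition: the stubs ⇒ the crux, by name -/

/-- **The line closes the crux modulo its stubs**: `stub_certificateOnInterval` supplies `U`, the window `(μ₁, μ₂)`, the
two-point density bracket and the per-accuracy block on the window; `stub_densityOfBracket` (LANDED p97590: the GC
energy-density limit exists and is antitone, has a differentiability point in the window; Griffiths' lemma; monotone
transport) supplies `μ ∈ (μ₁, μ₂)` with `n_{L+1}(U, μ) → d ∈ [13/20, 4/5]`; put `δ := 1 − d ∈ [1/5, 7/20]`; the certificate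
conjunct at `(U, μ)` is `stub_certificateOfPerAccuracy` (LANDED p98129, v3's composition factored). -/
theorem CapRgSymmetricCertificatePinned_of :
    Summit.HubbardSuperconductivity.HubbardSuperconductivity.Theses.AposterioriCapRg.CapRgSymmetricCertificatePinned := by
  obtain ⟨U, hU, μ₁, μ₂, h12, hlo, hhi, hcert⟩ := stub_certificateOnInterval
  obtain ⟨μ, hμ, d, hd, hdens⟩ := stub_densityOfBracket U μ₁ μ₂ _ _ h12 hlo hhi
  refine ⟨U, hU, 1 - d, ⟨by linarith [hd.2], by linarith [hd.1]⟩, μ, ?_,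
    stub_certificateOfPerAccuracy U μ (hcert μ hμ)⟩
  simpa only [sub_sub_cancel] using hdens

end Summit.HubbardSuperconductivity.CapRgSymmetricCertificatePinned.StrictContinuum
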